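import Summits.ValiantsHypothesis.ValiantsHypothesis.Theorems.BarrierLeverPrincipalMinorLayoutsCapacityBound

/-!
# Route BarrierLever — item `PartitionMinorsHitByVP` (stmt-ValiantsHypothesis-19717):
# the CAPACITY BOUND for BOUNDED-MULTIPLICITY determinantal templates (`K`-fold principal minors)

Helper file (`--supports stmt-ValiantsHypothesis-19717`; cell valiant-natproofs, rung V4, 𝒟-side door
(c); prover seat val-np-p6 gen 7). Definition-free, pure linear algebra over `ℂ` (outside the theses
cone: imports only val-np-p3's `…PrincipalMinorLayoutsCapacityBound`).

**Setting.** A `K`-FOLD PRINCIPAL-MINOR TEMPLATE is a square table `G : Matrix (Fin N) (Fin N) ℂ`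
with a labelling `π : Fin N → Fin (h+h)` of its indices by the variables `x_a = castAdd a`,
`y_c = natAdd c`, every label carried by AT MOST `K` indices. Its layout entry on (row set `U`, column
set `W`) is the sum of the principal minors of `G` over all TRANSVERSALS of `U ⊔ W̄` (index sets mapped
by `π` bijectively onto `U ⊔ W̄`):
`Φ_{G,π}(U, W) = Σ_{R ⊆ Fin N, π(R) = U ⊔ W̄, |R| = |U ⊔ W̄|} det G[R, R]`.
These are the partition coefficients `[x^U y^W] det(1 + diag(z_{π 1}, …, z_{π N})·G)` of a determinantal
witness in which every variable occupies at most `K` diagonal slots (equivalently, by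
`det(1 + P Qᵀ) = det(1 + Qᵀ P)`, of `det(C + Σ_v z_v A_v)` with `rank A_v ≤ K` for all `v`); `K = 1`,
`N = h+h`, `π = id` is the principal-minor witness of item 19126 (TNS), `K = 2h`, `N = 2h`·`2h` contains
the bi-affine determinant of `…TransversalMinorDoor` … .

**Theorem (`kfold_det_eq_zero_of_singleton_rows`).** Let `T ⊆ Fin h` and let `(u, w)` be a layout with
all rows EMPTY OR SINGLETONS and all columns inside `T`. If `r > (K|T|)² + 1` then the layout matrix
`(Φ_{G,π}(u_i, w_j))_{i,j}` is SINGULAR — for every `N`, `G` and every labelling `π` with fibres of size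
`≤ K` over the labels `ȳ_c`, `c ∈ T`. Proof: a transversal of `{â} ⊔ W̄` is `insert ρ R'` with `π ρ = â`
and `R'` a transversal of `W̄` (`sum_transversals_insert`); the principal minor on `insert ρ R'` is a
bordered determinant of `G[R']`, affine-bilinear in its border (val-np-p3's `TNSRefutation.pm_insert`,
`det_border`); hence `Φ({a}, W) = (Σ_ρ G_ρρ)·Φ(∅, W) + Σ_{z,z' ∈ π⁻¹(T̄)} (Σ_ρ G_{ρz} G_{z'ρ})·Ẽ_{z,z'}(W)`
with `Ẽ_{z,z'}(W) = Σ_{R'} E^{R'}_{z,z'}` independent of `a`: every row lies in the span of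
`1 + |π⁻¹(T̄)|² ≤ 1 + (K|T|)²` fixed vectors (`det_eq_zero_of_rows_mem_span`-style count, as in TNS).

So bounded-multiplicity determinantal witnesses need `K|T| ≥ 2^{|T|/2}` on the capacity layouts
(`|T| ≈ log₂ h`): multiplicity `K ≳ √h / log h` — the quantitative form of the scope caveat of
`…UniversalCertificateCapacityBarrier` («determinantal witnesses of rank ≳ √h are not obstructed»).

WHAT THIS IS NOT: nothing about item 19717 itself (layout-dependent witnesses); nothing on crux
stmt-ValiantsHypothesis-14610 or `VP ≠ VNP`.
-/

set_option linter.dupNamespace false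

open Matrix Finset

namespace Summit.ValiantsHypothesis.ValiantsHypothesis.Theorems.BarrierLever.KFoldDet

open Summit.ValiantsHypothesis.ValiantsHypothesis.Theorems.BarrierLever.TNSRefutation
  (det_border pm_insert pm_congr det_border_zero_row det_border_zero_col)

/-! ## 1. Transversals of a label set -/

/-- In a transversal the labelling is injective. -/
theorem injOn_of_transversal {N m : ℕ} (π : Fin N → Fin m) (L : Finset (Fin m)) (R : Finset (Fin N))
    (hR : R.image π = L ∧ R.card = L.card) : Set.InjOn π (R : Set (Fin N)) := by
  classical
  rw [← Finset.card_image_iff, hR.1, hR.2]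

/-- **Transversals of `insert a L`** (`a ∉ L`) are exactly the sets `insert ρ R'` with `π ρ = a` and
`R'` a transversal of `L`: the corresponding decomposition of a sum. -/
theorem sum_transversals_insert {N m : ℕ} (π : Fin N → Fin m) (L : Finset (Fin m)) (a : Fin m)
    (ha : a ∉ L) (f : Finset (Fin N) → ℂ) :
    ∑ R ∈ (Finset.univ : Finset (Fin N)).powerset.filter
        (fun R => R.image π = insert a L ∧ R.card = (insert a L).card), f R =
      ∑ ρ ∈ Finset.univ.filter (fun ρ : Fin N => π ρ = a),
        ∑ R' ∈ (Finset.univ : Finset (Fin N)).powerset.filter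
          (fun R' => R'.image π = L ∧ R'.card = L.card), f (insert ρ R') := by
  classical
  set Fib := Finset.univ.filter (fun ρ : Fin N => π ρ = a) with hFib
  set TrL := (Finset.univ : Finset (Fin N)).powerset.filter
    (fun R' => R'.image π = L ∧ R'.card = L.card) with hTrL
  set TrA := (Finset.univ : Finset (Fin N)).powerset.filter
    (fun R => R.image π = insert a L ∧ R.card = (insert a L).card) with hTrA
  have hmemTrL : ∀ R', R' ∈ TrL ↔ R'.image π = L ∧ R'.card = L.card := fun R' => by
    simp [hTrL]
  have hmemTrA : ∀ R, R ∈ TrA ↔ R.image π = insert a L ∧ R.card = (insert a L).card := fun R => by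
    simp [hTrA]
  have hmemFib : ∀ ρ, ρ ∈ Fib ↔ π ρ = a := fun ρ => by simp [hFib]
  -- `ρ ∉ R'` for `ρ` in the fibre of `a` and `R'` a transversal of `L`
  have hnot : ∀ ρ ∈ Fib, ∀ R' ∈ TrL, ρ ∉ R' := by
    intro ρ hρ R' hR' hmem
    apply ha
    rw [← ((hmemTrL R').mp hR').1, Finset.mem_image]
    exact ⟨ρ, hmem, (hmemFib ρ).mp hρ⟩
  -- the map `(ρ, R') ↦ insert ρ R'` is injective on `Fib ×ˢ TrL`
  have hinj : ∀ p ∈ Fib ×ˢ TrL, ∀ q ∈ Fib ×ˢ TrL,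
      insert p.1 p.2 = (insert q.1 q.2 : Finset (Fin N)) → p = q := by
    rintro ⟨ρ, R'⟩ hp ⟨ρ₂, R'₂⟩ hq heq
    rw [Finset.mem_product] at hp hq
    have hρ : ρ = ρ₂ := by
      have : ρ ∈ insert ρ₂ R'₂ := heq ▸ Finset.mem_insert_self ρ R'
      rcases Finset.mem_insert.mp this with h1 | h1
      · exact h1
      · exact absurd h1 (hnot ρ hp.1 R'₂ hq.2)
    subst hρ
    have h2 : R' = R'₂ := by
      have e1 : (insert ρ R').erase ρ = R' := Finset.erase_insert (hnot ρ hp.1 R' hp.2)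
      have e2 : (insert ρ R'₂).erase ρ = R'₂ := Finset.erase_insert (hnot ρ hq.1 R'₂ hq.2)
      rw [← e1, ← e2, heq]
    rw [h2]
  -- and its image is `TrA`
  have himage : (Fib ×ˢ TrL).image (fun p => insert p.1 p.2) = TrA := by
    ext R
    rw [Finset.mem_image, hmemTrA]
    constructor
    · rintro ⟨⟨ρ, R'⟩, hp, rfl⟩
      rw [Finset.mem_product] at hp
      obtain ⟨hL, hc⟩ := (hmemTrL R').mp hp.2
      refine ⟨?_, ?_⟩
      · rw [Finset.image_insert, (hmemFib ρ).mp hp.1, hL]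
      · rw [Finset.card_insert_of_notMem (hnot ρ hp.1 R' hp.2), Finset.card_insert_of_notMem ha, hc]
    · rintro ⟨hL, hc⟩
      have hinjR : Set.InjOn π (R : Set (Fin N)) := injOn_of_transversal π _ R ⟨hL, hc⟩
      have haR : a ∈ R.image π := by rw [hL]; exact Finset.mem_insert_self a L
      obtain ⟨ρ, hρR, hρa⟩ := Finset.mem_image.mp haR
      refine ⟨(ρ, R.erase ρ), ?_, Finset.insert_erase hρR⟩
      rw [Finset.mem_product, hmemFib, hmemTrL]
      refine ⟨hρa, ?_, ?_⟩
      · -- `π (R.erase ρ) = L`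
        have hsub : (R.erase ρ).image π ⊆ L := by
          intro b hb
          obtain ⟨x, hx, rfl⟩ := Finset.mem_image.mp hb
          have hxR : x ∈ R := Finset.mem_of_mem_erase hx
          have hxL : π x ∈ insert a L := by rw [← hL]; exact Finset.mem_image_of_mem π hxR
          rcases Finset.mem_insert.mp hxL with h1 | h1
          · exact absurd (hinjR hxR hρR (h1.trans hρa.symm)) (Finset.ne_of_mem_erase hx)
          · exact h1
        have hcard : L.card ≤ ((R.erase ρ).image π).card := by
          rw [Finset.card_image_of_injOn (hinjR.mono (by
              intro x hx; exact Finset.mem_of_mem_erase hx)),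
            Finset.card_erase_of_mem hρR, hc, Finset.card_insert_of_notMem ha]
          omega
        exact Finset.eq_of_subset_of_card_le hsub hcard
      · rw [Finset.card_erase_of_mem hρR, hc, Finset.card_insert_of_notMem ha]
        omega
  rw [← himage, Finset.sum_image hinj, Finset.sum_product]

/-! ## 2. The capacity bound -/

/-- **The capacity bound for `K`-fold principal-minor templates.** Let `T ⊆ Fin h` and `(u, w)` a
layout with empty-or-singleton rows and columns inside `T`; let every label `ȳ_c`, `c ∈ T`, be carried
by at most `K` indices of `π`. If `r > (K|T|)² + 1`, the layout matrix of the template is singular,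
for every table `G`. -/
theorem kfold_det_eq_zero_of_singleton_rows {N h r K : ℕ} (G : Matrix (Fin N) (Fin N) ℂ)
    (π : Fin N → Fin (h + h)) (T : Finset (Fin h))
    (hK : ∀ c ∈ T, (Finset.univ.filter (fun z : Fin N => π z = Fin.natAdd h c)).card ≤ K)
    (u w : Fin r → Finset (Fin h))
    (hu : ∀ i, u i = ∅ ∨ ∃ a, u i = {a}) (hw : ∀ j, w j ⊆ T)
    (hr : (K * T.card) * (K * T.card) + 1 < r) :
    (Matrix.of fun i j : Fin r =>
      ∑ R ∈ (Finset.univ : Finset (Fin N)).powerset.filter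
        (fun R => R.image π = (u i).map (Fin.castAddEmb h) ∪ (w j).map (Fin.natAddEmb h) ∧
          R.card = ((u i).map (Fin.castAddEmb h) ∪ (w j).map (Fin.natAddEmb h)).card),
        (G.submatrix (Subtype.val : ↥R → Fin N) (Subtype.val : ↥R → Fin N)).det).det = 0 := by
  classical
  set M := (Matrix.of fun i j : Fin r =>
      ∑ R ∈ (Finset.univ : Finset (Fin N)).powerset.filter
        (fun R => R.image π = (u i).map (Fin.castAddEmb h) ∪ (w j).map (Fin.natAddEmb h) ∧
          R.card = ((u i).map (Fin.castAddEmb h) ∪ (w j).map (Fin.natAddEmb h)).card),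
        (G.submatrix (Subtype.val : ↥R → Fin N) (Subtype.val : ↥R → Fin N)).det) with hM
  -- column data
  let Wb : Fin r → Finset (Fin (h + h)) := fun j => (w j).map (Fin.natAddEmb h)
  let Tr : Finset (Fin (h + h)) → Finset (Finset (Fin N)) := fun L =>
    (Finset.univ : Finset (Fin N)).powerset.filter (fun R => R.image π = L ∧ R.card = L.card)
  have hmemTr : ∀ L R, R ∈ Tr L ↔ R.image π = L ∧ R.card = L.card := fun L R => by simp [Tr]
  let D : Fin r → ℂ := fun j => ∑ R' ∈ Tr (Wb j),
    (G.submatrix (Subtype.val : ↥R' → Fin N) (Subtype.val : ↥R' → Fin N)).det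
  let EE : Finset (Fin N) → Fin N → Fin N → ℂ := fun R' z z' =>
    (Matrix.fromBlocks (G.submatrix (Subtype.val : ↥R' → Fin N) (Subtype.val : ↥R' → Fin N))
      (Matrix.of fun (d : ↥R') (_ : Unit) => if d.1 = z' then (1 : ℂ) else 0)
      (Matrix.of fun (_ : Unit) (d : ↥R') => if d.1 = z then (1 : ℂ) else 0)
      (Matrix.of fun (_ _ : Unit) => (0 : ℂ))).det
  let Et : Fin N → Fin N → Fin r → ℂ := fun z z' j => ∑ R' ∈ Tr (Wb j), EE R' z z'
  -- the indices labelled by `ȳ_c`, `c ∈ T`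
  set Z : Finset (Fin N) := Finset.univ.filter (fun z : Fin N => π z ∈ T.map (Fin.natAddEmb h))
    with hZ
  have hZcard : Z.card ≤ K * T.card := by
    have hZeq : Z = T.biUnion (fun c => Finset.univ.filter (fun z : Fin N => π z = Fin.natAdd h c)) := by
      ext z
      simp only [hZ, Finset.mem_filter, Finset.mem_univ, true_and, Finset.mem_biUnion,
        Finset.mem_map, Fin.natAddEmb_apply]
      constructor
      · rintro ⟨c, hc, hcz⟩; exact ⟨c, hc, hcz.symm⟩
      · rintro ⟨c, hc, hcz⟩; exact ⟨c, hc, hcz.symm⟩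
    rw [hZeq]
    calc (T.biUnion fun c => Finset.univ.filter fun z : Fin N => π z = Fin.natAdd h c).card
        ≤ ∑ c ∈ T, (Finset.univ.filter fun z : Fin N => π z = Fin.natAdd h c).card :=
          Finset.card_biUnion_le
      _ ≤ ∑ _c ∈ T, K := Finset.sum_le_sum fun c hc => hK c hc
      _ = K * T.card := by rw [Finset.sum_const, smul_eq_mul, mul_comm]
  -- transversals of `W̄_j` lie inside `Z`
  have hRZ : ∀ j, ∀ R' ∈ Tr (Wb j), R' ⊆ Z := by
    intro j R' hR' z hz
    rw [hZ, Finset.mem_filter]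
    refine ⟨Finset.mem_univ _, ?_⟩
    have : π z ∈ R'.image π := Finset.mem_image_of_mem π hz
    rw [((hmemTr _ _).mp hR').1] at this
    exact Finset.map_subset_map.mpr (hw j) this
  -- the spanning family
  let g : Option (↥Z × ↥Z) → (Fin r → ℂ) := fun o =>
    match o with
    | none => D
    | some (z, z') => Et z.1 z'.1
  have hrow : ∀ i, M i ∈ Submodule.span ℂ (Set.range g) := by
    intro i
    rcases hu i with h0 | ⟨a, ha⟩
    · -- empty row
      have hMi : M i = D := by
        funext j
        simp only [hM, Matrix.of_apply, D, Tr, Wb]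
        rw [h0, Finset.map_empty, Finset.empty_union]
      rw [hMi]
      exact Submodule.subset_span ⟨none, rfl⟩
    · -- singleton row `{a}`
      set â : Fin (h + h) := Fin.castAdd h a with hâ
      have hnot : ∀ j, â ∉ Wb j := by
        intro j hmem
        obtain ⟨c, -, hc⟩ := Finset.mem_map.1 hmem
        have h1 := congrArg Fin.val hc
        simp only [Fin.natAddEmb_apply, Fin.val_natAdd, hâ, Fin.val_castAdd] at h1
        have := a.isLt
        omega
      set Fib := Finset.univ.filter (fun ρ : Fin N => π ρ = â) with hFib
      have hmemFib : ∀ ρ, ρ ∈ Fib ↔ π ρ = â := fun ρ => by simp [hFib]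
      have hρR : ∀ j, ∀ ρ ∈ Fib, ∀ R' ∈ Tr (Wb j), ρ ∉ R' := by
        intro j ρ hρ R' hR' hmem
        apply hnot j
        rw [← ((hmemTr _ _).mp hR').1, Finset.mem_image]
        exact ⟨ρ, hmem, (hmemFib ρ).mp hρ⟩
      -- Step 1: decompose over (ρ, R') and expand the bordered determinant
      have hMi : ∀ j, M i j = ∑ ρ ∈ Fib, ∑ R' ∈ Tr (Wb j), (G ρ ρ *
            (G.submatrix (Subtype.val : ↥R' → Fin N) (Subtype.val : ↥R' → Fin N)).det +
          ∑ d : ↥R', ∑ d' : ↥R', G ρ d.1 * G d'.1 ρ *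
            (Matrix.fromBlocks (G.submatrix (Subtype.val : ↥R' → Fin N) (Subtype.val : ↥R' → Fin N))
              (Matrix.of fun (e : ↥R') (_ : Unit) => (Pi.single d' (1 : ℂ) : ↥R' → ℂ) e)
              (Matrix.of fun (_ : Unit) (e : ↥R') => (Pi.single d (1 : ℂ) : ↥R' → ℂ) e)
              (Matrix.of fun (_ _ : Unit) => (0 : ℂ))).det) := by
        intro j
        simp only [hM, Matrix.of_apply]
        have hL : (u i).map (Fin.castAddEmb h) ∪ (w j).map (Fin.natAddEmb h) = insert â (Wb j) := by
          rw [ha, Finset.map_singleton, Fin.castAddEmb_apply, ← Finset.insert_eq]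
        rw [hL, sum_transversals_insert π (Wb j) â (hnot j)]
        refine Finset.sum_congr rfl fun ρ hρ => Finset.sum_congr rfl fun R' hR' => ?_
        rw [pm_insert G R' ρ (hρR j ρ hρ R' hR'), det_border]
      -- Step 2: the double sum over `↥R'` as a double sum over `Z`
      have hsum : ∀ j ρ, ∀ R' ∈ Tr (Wb j), (∑ d : ↥R', ∑ d' : ↥R', G ρ d.1 * G d'.1 ρ *
            (Matrix.fromBlocks (G.submatrix (Subtype.val : ↥R' → Fin N) (Subtype.val : ↥R' → Fin N))
              (Matrix.of fun (e : ↥R') (_ : Unit) => (Pi.single d' (1 : ℂ) : ↥R' → ℂ) e)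
              (Matrix.of fun (_ : Unit) (e : ↥R') => (Pi.single d (1 : ℂ) : ↥R' → ℂ) e)
              (Matrix.of fun (_ _ : Unit) => (0 : ℂ))).det) =
          ∑ z ∈ Z, ∑ z' ∈ Z, G ρ z * G z' ρ * EE R' z z' := by
        intro j ρ R' hR'
        let F : Fin N → Fin N → ℂ := fun z z' => G ρ z * G z' ρ * EE R' z z'
        have hF0 : ∀ z z', z ∉ R' → F z z' = 0 := by
          intro z z' hz
          have hrow0 : (Matrix.of fun (_ : Unit) (d : ↥R') => if d.1 = z then (1 : ℂ) else 0) =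
              Matrix.of fun (_ : Unit) (_ : ↥R') => (0 : ℂ) := by
            ext _ d
            simp only [Matrix.of_apply]
            rw [if_neg (fun hd : (d : Fin N) = z => hz (hd ▸ d.2))]
          show G ρ z * G z' ρ * EE R' z z' = 0
          simp only [EE]
          rw [hrow0, det_border_zero_row, mul_zero]
        have hF0' : ∀ z z', z' ∉ R' → F z z' = 0 := by
          intro z z' hz'
          have hcol0 : (Matrix.of fun (d : ↥R') (_ : Unit) => if d.1 = z' then (1 : ℂ) else 0) =
              Matrix.of fun (_ : ↥R') (_ : Unit) => (0 : ℂ) := by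
            ext d _
            simp only [Matrix.of_apply]
            rw [if_neg (fun hd : (d : Fin N) = z' => hz' (hd ▸ d.2))]
          show G ρ z * G z' ρ * EE R' z z' = 0
          simp only [EE]
          rw [hcol0, det_border_zero_col, mul_zero]
        have hL : (∑ d : ↥R', ∑ d' : ↥R', G ρ d.1 * G d'.1 ρ *
            (Matrix.fromBlocks (G.submatrix (Subtype.val : ↥R' → Fin N) (Subtype.val : ↥R' → Fin N))
              (Matrix.of fun (e : ↥R') (_ : Unit) => (Pi.single d' (1 : ℂ) : ↥R' → ℂ) e)
              (Matrix.of fun (_ : Unit) (e : ↥R') => (Pi.single d (1 : ℂ) : ↥R' → ℂ) e)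
              (Matrix.of fun (_ _ : Unit) => (0 : ℂ))).det) = ∑ z ∈ R', ∑ z' ∈ R', F z z' := by
          rw [← Finset.sum_coe_sort R']
          refine Finset.sum_congr rfl fun d _ => ?_
          rw [← Finset.sum_coe_sort R']
          refine Finset.sum_congr rfl fun d' _ => ?_
          show _ = G ρ d.1 * G d'.1 ρ * EE R' d.1 d'.1
          simp only [EE]
          congr 3 <;> ext p q <;> simp only [Matrix.of_apply, Pi.single_apply, Subtype.ext_iff]
        rw [hL]
        have hsub : R' ⊆ Z := hRZ j R' hR'
        rw [Finset.sum_subset hsub (fun z _ hz => Finset.sum_eq_zero fun z' _ => hF0 z z' hz)]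
        exact Finset.sum_congr rfl fun z _ => Finset.sum_subset hsub (fun z' _ hz' => hF0' z z' hz')
      -- Step 3: the row as a combination of the spanning vectors
      have hMi2 : ∀ j, M i j = ∑ ρ ∈ Fib, ∑ R' ∈ Tr (Wb j), (G ρ ρ *
            (G.submatrix (Subtype.val : ↥R' → Fin N) (Subtype.val : ↥R' → Fin N)).det +
          ∑ z ∈ Z, ∑ z' ∈ Z, G ρ z * G z' ρ * EE R' z z') := by
        intro j
        rw [hMi j]
        refine Finset.sum_congr rfl fun ρ hρ => Finset.sum_congr rfl fun R' hR' => ?_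
        rw [hsum j ρ R' hR']
      have hMi' : M i = (∑ ρ ∈ Fib, G ρ ρ) • D +
          ∑ z ∈ Z, ∑ z' ∈ Z, (∑ ρ ∈ Fib, G ρ z * G z' ρ) • Et z z' := by
        funext j
        rw [hMi2 j]
        simp only [Pi.add_apply, Pi.smul_apply, Finset.sum_apply, smul_eq_mul]
        rw [Finset.sum_congr rfl fun ρ _ => Finset.sum_add_distrib, Finset.sum_add_distrib]
        congr 1
        · -- the `D`-part
          simp only [D]
          rw [Finset.sum_mul]
          refine Finset.sum_congr rfl fun ρ _ => ?_
          rw [Finset.mul_sum]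
        · -- the `Ẽ`-part: swap the summations
          simp only [Et]
          have hprod : ∀ z z', (∑ ρ ∈ Fib, G ρ z * G z' ρ) * (∑ R' ∈ Tr (Wb j), EE R' z z') =
              ∑ ρ ∈ Fib, ∑ R' ∈ Tr (Wb j), G ρ z * G z' ρ * EE R' z z' := fun z z' =>
            Finset.sum_mul_sum _ _ _ _
          simp only [hprod]
          calc ∑ ρ ∈ Fib, ∑ R' ∈ Tr (Wb j), ∑ z ∈ Z, ∑ z' ∈ Z, G ρ z * G z' ρ * EE R' z z'
              = ∑ ρ ∈ Fib, ∑ z ∈ Z, ∑ R' ∈ Tr (Wb j), ∑ z' ∈ Z, G ρ z * G z' ρ * EE R' z z' :=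
                Finset.sum_congr rfl fun ρ _ => Finset.sum_comm
            _ = ∑ z ∈ Z, ∑ ρ ∈ Fib, ∑ R' ∈ Tr (Wb j), ∑ z' ∈ Z, G ρ z * G z' ρ * EE R' z z' :=
                Finset.sum_comm
            _ = ∑ z ∈ Z, ∑ ρ ∈ Fib, ∑ z' ∈ Z, ∑ R' ∈ Tr (Wb j), G ρ z * G z' ρ * EE R' z z' :=
                Finset.sum_congr rfl fun z _ => Finset.sum_congr rfl fun ρ _ => Finset.sum_comm
            _ = ∑ z ∈ Z, ∑ z' ∈ Z, ∑ ρ ∈ Fib, ∑ R' ∈ Tr (Wb j), G ρ z * G z' ρ * EE R' z z' :=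
                Finset.sum_congr rfl fun z _ => Finset.sum_comm
      rw [hMi']
      refine Submodule.add_mem _ (Submodule.smul_mem _ _ (Submodule.subset_span ⟨none, rfl⟩)) ?_
      refine Submodule.sum_mem _ fun z hz => Submodule.sum_mem _ fun z' hz' => ?_
      exact Submodule.smul_mem _ _ (Submodule.subset_span ⟨some (⟨z, hz⟩, ⟨z', hz'⟩), rfl⟩)
  -- dimension count
  by_contra hdet
  have hunit : IsUnit M := (Matrix.isUnit_iff_isUnit_det M).2 (isUnit_iff_ne_zero.2 hdet)
  have hli : LinearIndependent ℂ M.row := Matrix.linearIndependent_rows_iff_isUnit.2 hunit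
  have hcard : Fintype.card (Fin r) = (Set.range M.row).finrank ℂ :=
    linearIndependent_iff_card_eq_finrank_span.1 hli
  have hle : Submodule.span ℂ (Set.range M.row) ≤ Submodule.span ℂ (Set.range g) :=
    Submodule.span_le.2 (by rintro _ ⟨i, rfl⟩; exact hrow i)
  have h1 : (Set.range M.row).finrank ℂ ≤ (Set.range g).finrank ℂ := Submodule.finrank_mono hle
  have h2 : (Set.range g).finrank ℂ ≤ Fintype.card (Option (↥Z × ↥Z)) := finrank_range_le_card g
  rw [Fintype.card_option, Fintype.card_prod, Fintype.card_coe] at h2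
  rw [Fintype.card_fin] at hcard
  have h3 : Z.card * Z.card ≤ (K * T.card) * (K * T.card) := Nat.mul_le_mul hZcard hZcard
  omega

end Summit.ValiantsHypothesis.ValiantsHypothesis.Theorems.BarrierLever.KFoldDet
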